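import Literature.AnabelianGeometry.EtaleTheta.SettingModel2CommutatorCusp
import Literature.AnabelianGeometry.EtaleTheta.SettingModelCuspAxis
import Literature.AnabelianGeometry.EtaleTheta.SettingModel2LevelKernels
import Literature.AnabelianGeometry.EtaleTheta.ThetaSettingOriginClauses
import Literature.AnabelianGeometry.EtaleTheta.SettingModelAugNotOpen
import HarnessLib

/-!
# The commutator-axis cusp model `model₂ᶜ`: origin profile — the cusp clause of `IsThm16Origin` and the
# printed CONSTRUCTION of `Y_N` from a cusp section (R2 = `GtpYNFromCusp`) HOLD, the latter NON-VACUOUSLY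

S. Mochizuki, *The étale theta function and its Frobenioid-theoretic manifestations*, Publ. RIMS **45** (2009)
[EtTh], §1, PRIMS PDF p. 13 (printed 239) [cite: MochizukiEtTh2009, §1 p.13]: «any decomposition group of a
cusp of `Y^log` determines, up to conjugation by `(Δ^tp_Y)^ell`, a section `G_K → (Π^tp_Y)^ell` […] whose
restriction to the open subgroup `G_{K_N} ⊆ G_K` determines an open immersion
`G_{K_N} ↪ (Π^tp_Y)^ell/N·(Δ^tp_Y)^ell` the image of which is stabilized by the conjugation action of `Π^tp_X`.
[…] Thus, this image determines a Galois covering `Y_N → Y` such that the resulting surjection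
`Π^tp_Y ↠ Gal(Y_N/Y)`, whose kernel we denote by `Π^tp_{Y_N}`, […]» — typed by abc-iut-L6-d5 / abc-iut-L2-t6 as
`Thm16Sub.GtpYNFromCusp` (debt R2 of the K3 chain `ThetaSetting.IsThm16Origin`, `ThetaSettingOriginClauses`).

Cell abc-iut, layer L2 (NV lane), seat abc-iut-w5-d165 (gen 4); PROOF-ONLY sequel (0 definitions) of this seat's
`SettingModel2CommutatorCusp` (`ThetaSetting.model₂ᶜ p`: abc-iut-L2-t1's untwisted finer model `Γ × G_{ℚ_p}` with
ONE cusp on the commutator axis `c^Ẑ`). STATUS OF R2 IN THE MODEL ZOO BEFORE THIS FILE: at every cusp-free model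
(`model`, `model₂`, `modelχ`, `modelχq`) it holds VACUOUSLY (`SettingModelOriginProfile.model_gtpYNFromCusp`,
`SettingModelChiOriginProfile.modelχ_gtpYNFromCusp`; abc-iut-w5-d051's `modelχq_origin_profile` «R2 ✓ (vacuous)»);
at the cusped χ-models (`curveχ′`, `curveχq′`, TORAL cusp `b^Ẑ`) it FAILS for `N ≥ 2` (abc-iut-w5-d029's consumer
check in `SettingModelChiCusp`: «`toEll(b^Ẑ) = (Δ^tp_Y)^ell` instead of `1`»). HERE:

* §1 the cuspidal decomposition groups of `model₂ᶜ` are exactly the `(γ₀ · c^Ẑ · γ₀⁻¹) × G_{ℚ_p}`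
  (`isCuspidalDecompositionGroup_model₂c_iff`); all of them lie in `Π^tp_Y` (`cuspidal_le_GtpY_model₂c`) —
  the cusp clause `exists_cuspidal_le_GtpY` of `IsThm16Origin` HOLDS (`exists_cuspidal_le_GtpY_model₂c`);
* §2 ell-coordinates: `toEll = mk' KEll₂`; the `y`-coordinate of the level map `ĥ_N` is a CLASS FUNCTION on
  `Γ` vanishing on the commutator axis; the `y`-PROFILE homomorphism `(Π^tp_X)^ell → ℤ/N` (`yLevel`, built
  inside the proofs) kills both the cusp image and `N·(Δ^tp_Y)^ell`; and every `γ ∈ Ker pr₂` with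
  `y_N(γ) = 0` is an `N`-th power modulo `Ker toEll` (`γ ≡ (b^s)^N`, `s ∈ Ẑ` — abc-iut-w5-d029's `bPowGfp`,
  abc-iut-w5-d024's `hHat_bPow`, the tree's `ZHatLevel.level_eq_one_iff_exists_pow`);
* §3 **`model₂c_gtpYNFromCusp (N) : Thm16Sub.GtpYNFromCusp (ThetaSetting.model₂ᶜ p) N`** for EVERY `N` — the
  first NON-VACUOUS kernel witness of R2: reading `Π^tp_{Y_N}` off a cusp section gives back abc-iut-L2-t1's
  `Π^tp_{Y_N} = Δ^tp_{Y_N} × G_{K_N}` because the commutator-axis inertia dies in `(Π^tp_X)^ell`;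
* §4 the ORIGIN PROFILE `model₂c_origin_profile`: guard `IsEtThOrigin` ✓, cusp clause ✓, R2 ✓ (all `N`),
  R3 ✓ (both theta quotients are quotient maps by construction); NOT examined here: R1
  (`KerToZIsCompactlyGenerated` — the Galois factor of `model₂` is DISCRETE) and TM₂. So the two clauses that no
  earlier model satisfied together — «a cusp in `Π^tp_Y`» and «R2 for all `N`» — are jointly consistent with the
  root interface and its guard.

HONEST LABEL: SEMI-SYNTHETIC model (untwisted; see `SettingModel2CommutatorCusp`), consistency evidence for the
hypothesis bundle only; nothing of [EtTh] asserted; no side taken on [IUTchIII] Cor. 3.12; typed ≠ proved.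
-/

noncomputable section

namespace Literature.AnabelianGeometry.EtaleTheta.SettingModel

open Literature.AnabelianGeometry.SemiGraphs
open Literature.AnabelianGeometry.AbsoluteAnabelian
open CategoryTheory Function _root_.Topology Thm16Sub
open scoped commutatorElement Pointwise

variable (p : ℕ) [Fact p.Prime]

/-! ## §1. The cuspidal decomposition groups of `model₂ᶜ` -/

/-- Conjugating the cusp datum: `(γ₀, σ₀) · (c^Ẑ × G_{ℚ_p}) · (γ₀, σ₀)⁻¹ = (γ₀ c^Ẑ γ₀⁻¹) × G_{ℚ_p}` (direct product:
the arithmetic factor is all of `G_{ℚ_p}`). [cite: MochizukiEtTh2009, §1 p.13] -/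
theorem conjAct_smul_cuspDecomp₂c (g : ConjAct (PiTp₂ p)) :
    g • cuspDecomp₂c p = (MulAut.conj (ConjAct.ofConjAct g).1 • cAxisGfp).prod ⊤ := by
  ext x
  rw [Subgroup.mem_smul_pointwise_iff_exists, Subgroup.mem_prod]
  constructor
  · rintro ⟨h, hh, rfl⟩
    refine ⟨?_, trivial⟩
    rw [ConjAct.smul_def, Subgroup.mem_smul_pointwise_iff_exists]
    exact ⟨h.1, (mem_cuspDecomp₂c_iff p h).mp hh, rfl⟩
  · rintro ⟨hx, -⟩
    rw [Subgroup.mem_smul_pointwise_iff_exists] at hx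
    obtain ⟨c, hc, hcx⟩ := hx
    refine ⟨(c, (ConjAct.ofConjAct g).2⁻¹ * x.2 * (ConjAct.ofConjAct g).2), ?_, ?_⟩
    · exact (mem_cuspDecomp₂c_iff p _).mpr hc
    · rw [ConjAct.smul_def]
      refine Prod.ext hcx ?_
      change (ConjAct.ofConjAct g).2 * ((ConjAct.ofConjAct g).2⁻¹ * x.2 * (ConjAct.ofConjAct g).2) *
        ((ConjAct.ofConjAct g).2)⁻¹ = x.2
      group

/-- **The cuspidal decomposition groups of `model₂ᶜ` are exactly the `(γ₀ c^Ẑ γ₀⁻¹) × G_{ℚ_p}`, `γ₀ ∈ Γ`.**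
[cite: MochizukiSemiAnbd2006, §6 p.71] -/
theorem isCuspidalDecompositionGroup_model₂c_iff (Dc : Subgroup (PiTp₂ p)) :
    (ThetaSetting.model₂c p).IsCuspidalDecompositionGroup Dc ↔
      ∃ γ₀ : Gfp, Dc = (MulAut.conj γ₀ • cAxisGfp).prod ⊤ := by
  constructor
  · rintro ⟨x, -, g, rfl⟩
    exact ⟨(ConjAct.ofConjAct g).1, conjAct_smul_cuspDecomp₂c p g⟩
  · rintro ⟨γ₀, rfl⟩
    refine ⟨(), trivial, ConjAct.toConjAct ((γ₀, 1) : PiTp₂ p), ?_⟩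
    change _ = ConjAct.toConjAct ((γ₀, 1) : PiTp₂ p) • cuspDecomp₂c p
    rw [conjAct_smul_cuspDecomp₂c]
    rfl

/-- `γ₀ c^Ẑ γ₀⁻¹ ⊆ Ker pr₂` (`Ker pr₂ ⊴ Γ` contains the commutator axis). [cite: MochizukiEtTh2009, §1 p.13] -/
theorem conj_cAxisGfp_le_ker_gfpSnd (γ₀ : Gfp) : MulAut.conj γ₀ • cAxisGfp ≤ gfpSnd.ker := by
  intro x hx
  rw [Subgroup.mem_smul_pointwise_iff_exists] at hx
  obtain ⟨c, hc, rfl⟩ := hx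
  rw [MulAut.smul_def, MulAut.conj_apply]
  exact (MonoidHom.normal_ker gfpSnd).conj_mem c (cAxisGfp_le_ker_gfpSnd hc) γ₀

/-- **Every cuspidal decomposition group of `model₂ᶜ` lies in `Π^tp_Y`** (the commutator axis has `a`-degree `0`).
[cite: MochizukiEtTh2009, §1 p.13] -/
theorem cuspidal_le_GtpY_model₂c {Dc : Subgroup (PiTp₂ p)}
    (h : (ThetaSetting.model₂c p).IsCuspidalDecompositionGroup Dc) : Dc ≤ (ThetaSetting.model₂c p).GtpY := by
  obtain ⟨γ₀, rfl⟩ := (isCuspidalDecompositionGroup_model₂c_iff p Dc).mp h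
  change (MulAut.conj γ₀ • cAxisGfp).prod ⊤ ≤ (toZM₂ p).ker
  rw [ker_toZM₂]
  exact Subgroup.prod_mono (conj_cAxisGfp_le_ker_gfpSnd γ₀) le_rfl

/-- **The cusp clause of `IsThm16Origin` HOLDS at `model₂ᶜ`**: there is a cuspidal decomposition group inside
`Π^tp_Y` («`X^log` is of type `(1,1)`»; cusps map to the vertex of the dual graph). [cite: MochizukiEtTh2009, §1 p.13] -/
theorem exists_cuspidal_le_GtpY_model₂c :
    ∃ Dc : Subgroup (ThetaSetting.model₂c p).PiTemp,
      (ThetaSetting.model₂c p).IsCuspidalDecompositionGroup Dc ∧ Dc ≤ (ThetaSetting.model₂c p).GtpY :=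
  ⟨cuspDecomp₂c p, ⟨(), trivial, 1, by rw [one_smul]⟩, cuspidal_le_GtpY_model₂c p ⟨(), trivial, 1, by
    rw [one_smul]⟩⟩

/-! ## §2. ell-coordinates at `model₂ᶜ` -/

/-- `Π^tp_X ↠ (Π^tp_X)^ell` at `model₂ᶜ` is the quotient map by `KEll₂`. [cite: MochizukiEtTh2009, §1 p.12] -/
theorem toEll_model₂c_eq : toEll (ThetaSetting.model₂c p) = QuotientGroup.mk' (KEll₂ p) := thetaToEllM₂_comp p

/-- Equality of ell-images: `toEll g = toEll h ↔ g⁻¹ h ∈ KEll₂`. [cite: MochizukiEtTh2009, §1 p.12] -/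
theorem toEll_model₂c_eq_iff (g h : PiTp₂ p) :
    toEll (ThetaSetting.model₂c p) g = toEll (ThetaSetting.model₂c p) h ↔ g⁻¹ * h ∈ KEll₂ p := by
  rw [toEll_model₂c_eq, QuotientGroup.mk'_apply, QuotientGroup.mk'_apply, QuotientGroup.eq]

/-- The `y`-coordinate of the level map is a class function on `Γ` (it factors through the abelian `(x, y)`-part
of the Heisenberg group). [cite: MochizukiEtTh2009, §1 p.13] -/
theorem levelHom_y_conj (N : ℕ+) (γ₀ γ : Gfp) : (levelHom N (γ₀ * γ * γ₀⁻¹)).y = (levelHom N γ).y := by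
  simp only [map_mul, map_inv, Heis.mul_y, Heis.inv_y]
  ring

/-- The commutator axis dies under the `y`-coordinate: `y_N(c^t) = 0` (`ĥ_N(c^t) = (0,0,t mod N)`).
[cite: MochizukiEtTh2009, §1 p.13] -/
theorem levelHom_y_cPowGfp (N : ℕ+) (t : ZH) : (levelHom N (cPowGfp t)).y = 0 := by
  change (hHat N (gfpFst (cPowGfp t))).y = 0
  rw [gfpFst_cPowGfp, hHat_cPow]

/-- … and so does every conjugate of it: `y_N = 0` on `γ₀ c^Ẑ γ₀⁻¹`. [cite: MochizukiEtTh2009, §1 p.13] -/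
theorem levelHom_y_eq_zero_of_mem_conj_cAxisGfp (N : ℕ+) {γ₀ γ : Gfp} (h : γ ∈ MulAut.conj γ₀ • cAxisGfp) :
    (levelHom N γ).y = 0 := by
  rw [Subgroup.mem_smul_pointwise_iff_exists] at h
  obtain ⟨_, ⟨t, rfl⟩, rfl⟩ := h
  rw [MulAut.smul_def, MulAut.conj_apply]
  change (levelHom N (γ₀ * cPowGfp t * γ₀⁻¹)).y = 0
  rw [levelHom_y_conj, levelHom_y_cPowGfp]

/-- Two elements of `Ker pr₂ × 1` have the same ell-image iff all their `y`-coordinates agree.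
[cite: MochizukiEtTh2009, §1 p.13] -/
theorem toEll_mk_one_eq_iff {γ γ' : Gfp} (hγ : γ ∈ gfpSnd.ker) (hγ' : γ' ∈ gfpSnd.ker) :
    toEll (ThetaSetting.model₂c p) ((γ, 1) : PiTp₂ p) = toEll (ThetaSetting.model₂c p) ((γ', 1) : PiTp₂ p) ↔
      ∀ N : ℕ+, (levelHom N γ).y = (levelHom N γ').y := by
  rw [toEll_model₂c_eq_iff, Prod.inv_mk, inv_one, Prod.mk_mul_mk, one_mul, mem_KEll₂_iff]
  have hk : γ⁻¹ * γ' ∈ gfpSnd.ker := gfpSnd.ker.mul_mem (gfpSnd.ker.inv_mem hγ) hγ'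
  constructor
  · rintro ⟨h, -⟩ N
    have hy := (h N).2
    change (levelHom N (γ⁻¹ * γ')).y = 0 at hy
    simp only [map_mul, map_inv, Heis.mul_y, Heis.inv_y] at hy
    linear_combination -hy
  · intro h
    refine ⟨fun N => ⟨levelHom_x_eq_zero hk, ?_⟩, rfl⟩
    change (levelHom N (γ⁻¹ * γ')).y = 0
    simp only [map_mul, map_inv, Heis.mul_y, Heis.inv_y, h N]
    ring

/-- `y_N(b^s) = s mod N` on abc-iut-w5-d029's `b`-axis in `Γ`. [cite: MochizukiEtTh2009, §1 p.13] -/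
theorem levelHom_y_bPowGfp (N : ℕ+) (s : ZH) :
    (levelHom N (bPowGfp s)).y = Multiplicative.toAdd (ZHatLevel.level N s) := by
  change (hHat N (gfpFst (bPowGfp s))).y = _
  rw [gfpFst_bPowGfp, hHat_bPow]

/-- `b^s ∈ Ker pr₂`. [cite: MochizukiEtTh2009, §1 p.13] -/
theorem bPowGfp_mem_ker_gfpSnd (s : ZH) : bPowGfp s ∈ gfpSnd.ker := bAxisGfp_le_ker_gfpSnd (bPowGfp_mem_bAxisGfp s)

/-- **`N`-th powers modulo `Ker toEll`**: an element `γ ∈ Ker pr₂` whose level-`N` `y`-coordinate vanishes has the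
same ell-image as `(b^s)^N` for some `s ∈ Ẑ` (its `y`-profile `t ∈ Ẑ` has `t mod N = 0`, so `t = s^N`).
[cite: MochizukiEtTh2009, §1 p.13] -/
theorem exists_toEll_eq_pow_of_levelHom_y_eq_zero (N : ℕ+) {γ : Gfp} (hγ : γ ∈ gfpSnd.ker)
    (hy : (levelHom N γ).y = 0) :
    ∃ s : ZH, toEll (ThetaSetting.model₂c p) ((γ, 1) : PiTp₂ p) =
      toEll (ThetaSetting.model₂c p) ((bPowGfp s, 1) : PiTp₂ p) ^ (N : ℕ) := by
  -- the `y`-profile `t` of `γ`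
  obtain ⟨t, ht⟩ := exists_zHat_forall_hHat_y_eq (gfpFst γ)
  have htN : ZHatLevel.level N t = 1 := by
    rw [← modN_eq_level, ← ofAdd_toAdd (modN N t), ht N]
    change Multiplicative.ofAdd (levelHom N γ).y = 1
    rw [hy, ofAdd_zero]
  obtain ⟨s, hs⟩ := (ZHatLevel.level_eq_one_iff_exists_pow N t).mp htN
  refine ⟨s, ?_⟩
  rw [← map_pow, Prod.pow_mk, one_pow]
  rw [toEll_mk_one_eq_iff p hγ (gfpSnd.ker.pow_mem (bPowGfp_mem_ker_gfpSnd s) _)]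
  intro M
  rw [map_pow]
  change (hHat M (gfpFst γ)).y = ((levelHom M (bPowGfp s)) ^ (N : ℕ)).y
  -- `y` of an `N`-th power in the Heisenberg group is `N • y`
  have hpow : ∀ (h : Heis (ZMod M)) (n : ℕ), (h ^ n).y = n • h.y := by
    intro h n
    induction n with
    | zero => simp
    | succ n ih => rw [pow_succ, Heis.mul_y, ih, succ_nsmul]
  rw [hpow, levelHom_y_bPowGfp, ← ht M, modN_eq_level, ← hs, map_pow, toAdd_pow]

/-- **`N·(Δ^tp_Y)^ell` in coordinates**: `w ∈ ellPowersY N` iff `w = toEll(δ, 1)^N` for some `δ ∈ Ker pr₂`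
(`(Δ^tp_Y)^ell` is abelian — commutators of `Γ` die in `(Π^tp_X)^ell` — so the `N`-th powers form a subgroup).
[cite: MochizukiEtTh2009, §1 p.13] -/
theorem mem_ellPowersY_model₂c_iff (N : ℕ+) (w : (ThetaSetting.model₂c p).GtpEll) :
    w ∈ ellPowersY (ThetaSetting.model₂c p) N ↔
      ∃ δ : Gfp, δ ∈ gfpSnd.ker ∧ w = toEll (ThetaSetting.model₂c p) ((δ, 1) : PiTp₂ p) ^ (N : ℕ) := by
  -- abbreviations
  have hDtpY : ∀ g : PiTp₂ p, g ∈ (ThetaSetting.model₂c p).DtpY ↔ g.1 ∈ gfpSnd.ker ∧ g.2 = 1 := by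
    intro g
    change g ∈ (toZM₂ p).ker ⊓ (curve₂c p).DeltaTemp ↔ _
    rw [Subgroup.mem_inf, ker_toZM₂, Subgroup.mem_prod, curve₂c_deltaTemp, mem_deltaTemp₂_iff]
    exact ⟨fun ⟨⟨h1, _⟩, h2⟩ => ⟨h1, h2⟩, fun ⟨h1, h2⟩ => ⟨⟨h1, trivial⟩, h2⟩⟩
  -- ell-images of elements of `Ker pr₂ × 1` commute
  have hcomm : ∀ δ₁ δ₂ : Gfp, δ₁ ∈ gfpSnd.ker → δ₂ ∈ gfpSnd.ker →
      Commute (toEll (ThetaSetting.model₂c p) ((δ₁, 1) : PiTp₂ p)) (toEll (ThetaSetting.model₂c p) ((δ₂, 1) : PiTp₂ p)) := by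
    intro δ₁ δ₂ h₁ h₂
    rw [Commute, SemiconjBy, ← map_mul, ← map_mul, Prod.mk_mul_mk, Prod.mk_mul_mk, mul_one,
      toEll_mk_one_eq_iff p (gfpSnd.ker.mul_mem h₁ h₂) (gfpSnd.ker.mul_mem h₂ h₁)]
    intro M
    simp only [map_mul, Heis.mul_y]
    ring
  constructor
  · intro hw
    refine Subgroup.closure_induction (p := fun w _ => ∃ δ : Gfp, δ ∈ gfpSnd.ker ∧
        w = toEll (ThetaSetting.model₂c p) ((δ, 1) : PiTp₂ p) ^ (N : ℕ)) ?_ ?_ ?_ ?_ hw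
    · rintro _ ⟨_, ⟨g, hg, rfl⟩, rfl⟩
      obtain ⟨h1, h2⟩ := (hDtpY g).mp hg
      refine ⟨g.1, h1, ?_⟩
      have : g = ((g.1, 1) : PiTp₂ p) := Prod.ext rfl h2
      rw [← this]
    · exact ⟨1, one_mem _, by rw [← map_pow, Prod.pow_mk, one_pow, one_pow, Prod.mk_one_one, map_one]⟩
    · rintro _ _ _ _ ⟨δ₁, h₁, rfl⟩ ⟨δ₂, h₂, rfl⟩
      refine ⟨δ₁ * δ₂, gfpSnd.ker.mul_mem h₁ h₂, ?_⟩
      rw [← (hcomm δ₁ δ₂ h₁ h₂).mul_pow, ← map_mul, Prod.mk_mul_mk, mul_one]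
    · rintro _ _ ⟨δ, hδ, rfl⟩
      refine ⟨δ⁻¹, gfpSnd.ker.inv_mem hδ, ?_⟩
      rw [← inv_pow, ← map_inv, Prod.inv_mk, inv_one]
  · rintro ⟨δ, hδ, rfl⟩
    refine Subgroup.subset_closure ⟨toEll (ThetaSetting.model₂c p) ((δ, 1) : PiTp₂ p), ⟨(δ, 1), ?_, rfl⟩, rfl⟩
    exact (hDtpY _).mpr ⟨hδ, rfl⟩

/-! ## §3. R2 — `Π^tp_{Y_N}` read off a cusp section — HOLDS at `model₂ᶜ`, for every `N` -/

/-- **R2 (`Thm16Sub.GtpYNFromCusp`) HOLDS NON-VACUOUSLY at `model₂ᶜ`, for every `N`**: for every cuspidal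
decomposition group `Dc = (γ₀ c^Ẑ γ₀⁻¹) × G_{ℚ_p}` (all lie in `Π^tp_Y`), an element `g ∈ Π^tp_X` lies in
abc-iut-L2-t1's `Π^tp_{Y_N} = Δ^tp_{Y_N} × G_{K_N}` iff `g ∈ Π^tp_Y`, `aug g ∈ G_{K_N}` and
`toEll g ∈ toEll(Dc ∩ aug⁻¹ G_{K_N}) · N·(Δ^tp_Y)^ell` — because the commutator-axis inertia dies in `(Π^tp_X)^ell`
(«the cusp section»), the level-`N` `y`-coordinate is a homomorphism on `(Π^tp_X)^ell` killing both the cusp image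
and the `N`-th powers, and an element of `Ker pr₂` with `y_N = 0` is an `N`-th power modulo `Ker toEll`.
[cite: MochizukiEtTh2009, §1 p.13] -/
theorem model₂c_gtpYNFromCusp (N : ℕ+) : GtpYNFromCusp (ThetaSetting.model₂c p) N := by
  intro Dc hDc _ g
  obtain ⟨γ₀, rfl⟩ := (isCuspidalDecompositionGroup_model₂c_iff p Dc).mp hDc
  -- the `y`-profile homomorphism at level `N` on `(Π^tp_X)^ell = Π^tp_X / KEll₂`
  let yN : PiTp₂ p →* Multiplicative (ZMod N) :=
    (Heis.yHom).comp ((levelHom N).comp (MonoidHom.fst Gfp (Gam p)))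
  have hyN : ∀ x : PiTp₂ p, yN x = Multiplicative.ofAdd (levelHom N x.1).y := fun x => rfl
  have hker : KEll₂ p ≤ yN.ker := by
    intro x hx
    have hy : (hHat N (x.1 : F₂hatT × Multiplicative ℤ).1).y = 0 := (((mem_KEll₂_iff p x).mp hx).1 N).2
    rw [MonoidHom.mem_ker, hyN]
    change Multiplicative.ofAdd (hHat N (x.1 : F₂hatT × Multiplicative ℤ).1).y = 1
    rw [hy, ofAdd_zero]
  let yLevel : (ThetaSetting.model₂c p).GtpEll →* Multiplicative (ZMod N) := QuotientGroup.lift (KEll₂ p) yN hker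
  have hyLevel : ∀ x : PiTp₂ p, yLevel (toEll (ThetaSetting.model₂c p) x) = Multiplicative.ofAdd (levelHom N x.1).y := by
    intro x
    rw [toEll_model₂c_eq]
    exact hyN x
  -- unfold the model's data
  change g ∈ YN₂ p N ↔ g ∈ (toZM₂ p).ker ∧ augM₂ p g ∈ (fieldKN (⊥ : IntermediateField ℚ_[p] (PadicAlgCl p))
    (qModel p) N).fixingSubgroup ∧ _
  rw [YN₂, Subgroup.mem_prod, ker_toZM₂, Subgroup.mem_prod]
  constructor
  · rintro ⟨h1, h2⟩
    have h1' : g.1 ∈ gfpSnd.ker := dY_le N h1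
    refine ⟨⟨h1', trivial⟩, h2, ?_⟩
    -- `toEll g = toEll(1, g.2) · toEll(g.1, 1)`
    have hsplit : g = ((1, g.2) : PiTp₂ p) * ((g.1, 1) : PiTp₂ p) := by
      refine Prod.ext ?_ ?_ <;> simp
    rw [hsplit, map_mul]
    refine Subgroup.mul_mem_sup ?_ ?_
    · -- the Galois part lies in the image of `Dc ∩ aug⁻¹ G_{K_N}`
      refine ⟨((1, g.2) : PiTp₂ p), Subgroup.mem_inf.mpr ⟨Subgroup.mem_prod.mpr ⟨one_mem _, trivial⟩, ?_⟩, rfl⟩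
      exact h2
    · -- the geometric part is an `N`-th power modulo `Ker toEll`
      have hy : (levelHom N g.1).y = 0 := (Subgroup.mem_comap.mp (Subgroup.mem_inf.mp h1).2).2
      obtain ⟨s, hs⟩ := exists_toEll_eq_pow_of_levelHom_y_eq_zero p N h1' hy
      rw [hs]
      exact ((mem_ellPowersY_model₂c_iff p N _).mpr ⟨bPowGfp s, bPowGfp_mem_ker_gfpSnd s, rfl⟩)
  · rintro ⟨⟨h1, -⟩, h2, h3⟩
    refine ⟨Subgroup.mem_inf.mpr ⟨h1, Subgroup.mem_comap.mpr ⟨levelHom_x_eq_zero h1, ?_⟩⟩, h2⟩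
    -- apply the `y`-profile homomorphism: it kills the cusp image and the `N`-th powers
    have hA : ((((MulAut.conj γ₀ • cAxisGfp).prod ⊤ : Subgroup (PiTp₂ p)) ⊓
        ((fieldKN (⊥ : IntermediateField ℚ_[p] (PadicAlgCl p)) (qModel p) N).fixingSubgroup).comap
          (augM₂ p).toMonoidHom).map (toEll (ThetaSetting.model₂c p))) ≤ yLevel.ker := by
      rintro _ ⟨x, hx, rfl⟩
      obtain ⟨hx1, -⟩ := Subgroup.mem_prod.mp (Subgroup.mem_inf.mp hx).1
      rw [MonoidHom.mem_ker, hyLevel, levelHom_y_eq_zero_of_mem_conj_cAxisGfp N hx1, ofAdd_zero]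
    have hB : ellPowersY (ThetaSetting.model₂c p) N ≤ yLevel.ker := by
      intro w hw
      obtain ⟨δ, -, rfl⟩ := (mem_ellPowersY_model₂c_iff p N w).mp hw
      rw [MonoidHom.mem_ker, map_pow, hyLevel, ← ofAdd_nsmul, nsmul_eq_mul, ZMod.natCast_self, zero_mul,
        ofAdd_zero]
    have hg : toEll (ThetaSetting.model₂c p) g ∈ yLevel.ker := sup_le hA hB h3
    rw [MonoidHom.mem_ker, hyLevel, ← ofAdd_zero] at hg
    exact Multiplicative.ofAdd.injective hg

/-! ## §4. The origin profile of `model₂ᶜ` -/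

/-- R3 at `model₂ᶜ`: `Π^tp_X ↠ (Π^tp_X)^Θ` is a quotient map (a `QuotientGroup.mk`). [cite: MochizukiEtTh2009, §1 p.12] -/
theorem isQuotientMap_toTheta_model₂c : IsQuotientMap (ThetaSetting.model₂c p).toTheta :=
  QuotientGroup.isQuotientMap_mk (N := KTheta₂ p)

/-- R3 at `model₂ᶜ`, second quotient: `(Π^tp_X)^Θ ↠ (Π^tp_X)^ell` is a quotient map (both sides are quotients of
`Π^tp_X` and the composite is the quotient map by `KEll₂`). [cite: MochizukiEtTh2009, §1 p.12] -/
theorem isQuotientMap_thetaToEll_model₂c : IsQuotientMap (ThetaSetting.model₂c p).thetaToEll := by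
  have hc : IsQuotientMap ((ThetaSetting.model₂c p).thetaToEll ∘ (ThetaSetting.model₂c p).toTheta) := by
    have h : ((ThetaSetting.model₂c p).thetaToEll ∘ (ThetaSetting.model₂c p).toTheta : PiTp₂ p → GEll₂ p) =
        (QuotientGroup.mk' (KEll₂ p) : PiTp₂ p → GEll₂ p) := by
      funext x
      exact DFunLike.congr_fun (thetaToEllM₂_comp p) x
    rw [h]
    exact QuotientGroup.isQuotientMap_mk (N := KEll₂ p)
  exact hc.of_comp (ThetaSetting.model₂c p).continuous_toTheta (ThetaSetting.model₂c p).continuous_thetaToEll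

/-- **ORIGIN PROFILE of `model₂ᶜ`**: the guard `IsEtThOrigin`, the CUSP CLAUSE of `IsThm16Origin` (a cuspidal
decomposition group inside `Π^tp_Y`), R2 `GtpYNFromCusp` for EVERY `N` (non-vacuously), and R3 (both theta
quotients are quotient maps) hold TOGETHER — the first model of the tree where «a cusp in `Π^tp_Y`» and «R2 for all
`N`» coexist. NOT examined: R1 `KerToZIsCompactlyGenerated` (the Galois factor of `model₂` is discrete) and TM₂.
Consistency evidence only. [cite: MochizukiEtTh2009, §1 p.13] -/
theorem model₂c_origin_profile :
    (ThetaSetting.model₂c p).IsEtThOrigin ∧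
    (∃ Dc : Subgroup (ThetaSetting.model₂c p).PiTemp,
      (ThetaSetting.model₂c p).IsCuspidalDecompositionGroup Dc ∧ Dc ≤ (ThetaSetting.model₂c p).GtpY) ∧
    (∀ N : ℕ+, GtpYNFromCusp (ThetaSetting.model₂c p) N) ∧
    IsQuotientMap (ThetaSetting.model₂c p).toTheta ∧ IsQuotientMap (ThetaSetting.model₂c p).thetaToEll :=
  ⟨ThetaSetting.model₂c_isEtThOrigin p, exists_cuspidal_le_GtpY_model₂c p, model₂c_gtpYNFromCusp p,
    isQuotientMap_toTheta_model₂c p, isQuotientMap_thetaToEll_model₂c p⟩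

/-- **NON-VACUITY of «guard + a cusp in `Π^tp_Y` + R2 for all `N`»** as an `∃`-statement over `ThetaSetting p`.
[cite: MochizukiEtTh2009, §1 p.13] -/
theorem _root_.Literature.AnabelianGeometry.EtaleTheta.ThetaSetting.exists_isEtThOrigin_cusp_gtpYNFromCusp :
    ∃ D : ThetaSetting p, D.IsEtThOrigin ∧
      (∃ Dc : Subgroup D.PiTemp, D.IsCuspidalDecompositionGroup Dc ∧ Dc ≤ D.GtpY) ∧
      ∀ N : ℕ+, GtpYNFromCusp D N :=
  ⟨ThetaSetting.model₂c p, ThetaSetting.model₂c_isEtThOrigin p, exists_cuspidal_le_GtpY_model₂c p,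
    model₂c_gtpYNFromCusp p⟩

/-! ## §5 (v2, append-only). The continuous-section law C9 FAILS at `model₂ᶜ` (discrete Galois factor) -/

/-- **No continuous section of the augmentation at `model₂ᶜ`** (census item C9 «`∃ s : G_K →* Π^tp_X` continuous
with `aug ∘ s = id` and values in `D_x`» — here even WITHOUT the `D_x`-constraint): the arithmetic factor `Gam p`
of abc-iut-L2-t1's `model₂` is a DISCRETE copy of `G_{ℚ_p}`, so a continuous section would make the identity
`G_{ℚ_p} → G_{ℚ_p}^{disc}` continuous on the compact infinite `G_K = G_{ℚ_p}` — impossible. Consequence for the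
13:00Z census: the bundle «C3 ∧ C9 (∧ C16)» (`CuspLaws`) has NO witness at `model₂ᶜ` (C3 ✓ by
`map_toTheta_inertia_model₂c`, C9 ✗ here) nor at the χ-models (C9 ✓, C3 ✗); a joint witness needs the untwisted
KRULL carrier `Γ ⋊₁ G_{ℚ_p}` with the commutator-axis cusp (abc-iut-L2-t10's K1a). [cite: MochizukiEtTh2009, §1 p.13] -/
theorem not_exists_continuous_section_model₂c :
    ¬ ∃ s : ↥(ThetaSetting.model₂c p).GK →* (ThetaSetting.model₂c p).PiTemp,
      Continuous s ∧ ∀ σ, (ThetaSetting.model₂c p).aug (s σ) = σ := by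
  rintro ⟨s, hs, hsec⟩
  -- `G_K = ⊤ ⊆ G_{ℚ_p}` (`K = ℚ_p`)
  have hGK : (ThetaSetting.model₂c p).GK = ⊤ := by
    change (⊥ : IntermediateField ℚ_[p] (PadicAlgCl p)).fixingSubgroup = ⊤
    exact IntermediateField.fixingSubgroup_bot
  -- the second component of `s` is injective (it is the inclusion `G_K ⊆ G_{ℚ_p}`) and continuous into a DISCRETE group
  have h2 : ∀ σ : ↥(ThetaSetting.model₂c p).GK, Gam.toGQp p (s σ).2 = (σ : GQp p) := fun σ => hsec σ
  have hinj : Function.Injective fun σ : ↥(ThetaSetting.model₂c p).GK => (s σ).2 := by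
    intro σ τ h
    apply Subtype.ext
    rw [← h2 σ, ← h2 τ]
    exact congrArg (Gam.toGQp p) h
  have hcont : Continuous fun σ : ↥(ThetaSetting.model₂c p).GK => (s σ).2 := continuous_snd.comp hs
  -- hence `G_K` is discrete …
  have hdisc : DiscreteTopology ↥(ThetaSetting.model₂c p).GK := by
    rw [discreteTopology_iff_isOpen_singleton]
    intro σ
    have : ({σ} : Set ↥(ThetaSetting.model₂c p).GK) = (fun τ => (s τ).2) ⁻¹' {(s σ).2} := by
      ext τ
      simp only [Set.mem_singleton_iff, Set.mem_preimage]
      exact ⟨fun h => by rw [h], fun h => hinj h⟩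
    rw [this]
    exact (isOpen_discrete _).preimage hcont
  -- … but it is compact (here `G_K = G_{ℚ_p}`, a compact group) and infinite: contradiction
  haveI : CompactSpace (GQp p) := compactSpace_GQp p
  haveI : Infinite (GQp p) := infinite_GQp p
  haveI : CompactSpace ↥(ThetaSetting.model₂c p).GK := by
    refine isCompact_iff_compactSpace.mp ?_
    rw [hGK, Subgroup.coe_top]
    exact isCompact_univ
  haveI : Infinite ↥(ThetaSetting.model₂c p).GK :=
    Infinite.of_injective (fun σ : GQp p => (⟨σ, by rw [hGK]; trivial⟩ : ↥(ThetaSetting.model₂c p).GK))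
      (fun _ _ h => congrArg Subtype.val h)
  haveI := hdisc
  haveI : Finite ↥(ThetaSetting.model₂c p).GK := finite_of_compact_of_discrete
  exact not_finite (↥(ThetaSetting.model₂c p).GK)

end Literature.AnabelianGeometry.EtaleTheta.SettingModel

end
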